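import Summits.QuantumFields.YangMills.Theses.WeakCouplingRates
import Summits.QuantumFields.YangMills.Theorems.WeakCouplingRatesBulkDominatesColdBoxWDefs
import Summits.QuantumFields.YangMills.Theorems.WeakCouplingRatesBulkDominatesColdBoxWStubLargeFieldRarity
import Summits.QuantumFields.YangMills.Theorems.WeakCouplingRatesBulkDominatesColdBoxWStubDlrAssembly
import Summits.QuantumFields.YangMills.Theorems.WeakCouplingRatesLargeFieldTail

/-!
# Line `dlr-chessboard` v4 — LEAD RESHAPE (tree-first) of the owner's v2 for crux `BulkDominatesColdBoxW` (stmt-QuantumFields-19609)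

Lead: fleet seat `prover-ym-wcr-19609-p1-g0-0` (unit `ym-wcr-19609-p1`, 2026-08-26).  v4 = v3 + **stub L3 `stub_dlrAssembly` CLOSED** by the
tree theorem `Theorems.WeakCouplingRates.stub_dlrAssembly` (`Theorems/WeakCouplingRatesBulkDominatesColdBoxWStubDlrAssembly.lean` +
`…DlrPlumbing.lean`, p447917: DLR equations of the torus state for `boxEdges 4 (2H+1)` on torus sides `L+1 > 2(2H+T+2)`, translation
invariance, the abstract law of total covariance with the bad event `{some corona plaquette > β^{2δ−1}}` of mass `≤ 6(2H+3)⁴e^{−β^δ}` by L2,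
and the window arithmetic; `η = η₁/2`).  Open after v4: `stub_goodBoundaryCovStable` (L1a, XL), `stub_goodBoundaryMeanSmooth` (L1b, L),
`stub_boxPolyFloor` (= items 19608 + 19457).  v3 = the owner's registered v2
(`pub/ym-beyond/p3-g13-files/LINE-dlr-chessboard-W.v2.lean`, sha16 021c654069d76526, planner ym-beyond-p3 g13) with exactly TWO changes and
NO change to any registered stub signature (byte-identical `Stmt.stub_*` abbrevs and stub headers):
1. the line's seven posited objects (`PlaquetteLargeFieldRarity`, `boxKernel`, `CrudeGood`, `GoodBoundaryCovStable`, `GoodBoundaryMeanSmooth`,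
   `BoxPolyFloor`, `DlrAssembly`) are no longer declared here: they are IMPORTED from the tree module
   `Theorems/WeakCouplingRatesBulkDominatesColdBoxWDefs.lean` (p445725, bodies verbatim = v2's) through the `open … Theorems.WeakCouplingRates` below,
   so that every stub lands BY NAME against tree objects;
2. **stub L2 `stub_largeFieldRarity` is CLOSED** — ALL torus sides, every `δ > 0` — by the tree theorem
   `Theorems.WeakCouplingRates.stub_largeFieldRarity` (`Theorems/WeakCouplingRatesBulkDominatesColdBoxWStubLargeFieldRarity.lean`; content
   `Theorems/WeakCouplingRatesLargeFieldTailAllSides.lean`, p445390: odd sides via the tree's iterated site-reflection doubling on the odd torus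
   `SoloBlind.wilsonExpectation_exp_plaquetteCost_le` + crude partition-function bounds; even sides `su2_measureReal_plaqCost_ge_le`).
Open stubs after v3: `stub_goodBoundaryCovStable` (L1a, XL, load-bearing), `stub_goodBoundaryMeanSmooth` (L1b, L), `stub_boxPolyFloor`
(= BOX_W 19608 + FLOOR 19457 + arithmetic), `stub_dlrAssembly` (L3, M — the lead's next target).  The v2 module docstring follows verbatim.

# Line `dlr-chessboard` v2 — WINDOW-PARAMETRIC re-cut for crux `BulkDominatesColdBoxW` (stmt-QuantumFields-19609; replaces 19455 `BulkDominatesColdBox`)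

Owner: planner `ym-beyond-p3` g13 (2026-08-26), route `WeakCouplingRates` rev 2 (commit ec0f9e61ceaa).  v2 = the registered v1
(`pub/ym-beyond/p3-g12-files/LINE-dlr-chessboard.lean`, sha16 920e42947bc1df1d, registered against the now-RETIRED item 19455 at the fixed
parameter point (A, δ, θ, K) = (1/200, 1/50, 1/9, 41/20)) with the SAME objects and predicates (`PlaquetteLargeFieldRarity`, `CrudeGood`,
`GoodBoundaryCovStable`, `GoodBoundaryMeanSmooth`, `BoxPolyFloor`, `DlrAssembly` — verbatim) and the stubs made PARAMETRIC IN THE BOX EXPONENT θ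
along the one-parameter family `(A, δ, θ, K) = (θ/20, θ/5, θ, 2 + θ/2)` (window check: K + 4δ + 2A = 2 + 1.4θ < 2 + 2θ; 5A + 2δ = 0.65θ < θ;
at θ = 1/50 this is exactly the point (1/1000, 1/250, 1/50, 2.01) named in the crux docstring), each one-scale stub under a ceiling θ₁ of the
prover's choosing — so that the composition delivers exponents below EVERY θ₀, as the rev-2 crux `BulkDominatesColdBoxW := ∀ θ₀ > 0, ∃ 0 < A < θ ≤ θ₀,
BulkDominatesBox A θ` demands (the deciding theorem instantiates it at BOX_W's ceiling).

## Stubs, sizes, and the LINE №57 «consumes:» audit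
* L2 `stub_largeFieldRarity` : ∀ δ > 0, `PlaquetteLargeFieldRarity δ` (ALL large torus sides; size M) — consumes `0 < δ` (threshold β^{2δ−1} above the
  Gaussian scale), `β₀ ≤ β`, `∀ᶠ L` (all large sides: odd sides need the mixed RP / odd-period chessboard folding); EVEN sides = the tree theorem
  `Theorems.WeakCouplingRates.stub_largeFieldRarityEven` (p411836), cited by name below (CLOSED half).
* L1a `stub_goodBoundaryCovStable` : ∃ θ₁ > 0, ∀ 0 < θ ≤ θ₁, ∃ η₁ > 0, `GoodBoundaryCovStable (θ/20) θ (θ/5) η₁` (LOAD-BEARING, size XL) — consumes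
  `0 < θ` (box grows), `θ ≤ θ₁` (one-scale small-field expansion around the small background extending a crude-good datum: union/volume counts over
  β^{4θ} plaquettes), `CrudeGood β δ H ω` (THE hypothesis: boundary plaquettes ≤ β^{2δ−1}), `β₀ ≤ β` — no idle binder.
* L1b `stub_goodBoundaryMeanSmooth` : ∃ θ₁ > 0, ∀ 0 < θ ≤ θ₁, `GoodBoundaryMeanSmooth (θ/20) θ (θ/5)` (size L) — consumes `CrudeGood` (small Dirichlet
  data ⇒ small smooth background, elliptic regularity), `0 < θ`, `θ ≤ θ₁`, `β₀ ≤ β` — no idle binder.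
* `stub_boxPolyFloor` : ∃ θ₁ > 0, ∀ 0 < θ ≤ θ₁, `BoxPolyFloor (θ/20) θ (2 + θ/2)` (size S–M) — NOT independent content: it is the route's crux BOX_W
  (`ColdBoxTwoPointFloorW`, item 19608) + support FLOOR (`CurvatureCorrPowerFloor`, item 19457) + rpow arithmetic (c·β^{−2}·C(⌈β^{θ/20}⌉)² ≥
  (cκ²/256)·β^{−2−0.4θ} ≥ β^{−(2+θ/2)} eventually); lands as a one-file consequence the day those two items close (or directly).  consumes `θ ≤ θ₁`
  (:= BOX_W's ceiling), `0 < θ`.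
* L3 `stub_dlrAssembly` : `DlrAssembly` (fully parametric already in v1; size M, probability + DLR plumbing) — consumes every hypothesis (law of total
  covariance, good/bad split with |c| ≤ 4, union bound over ≤ 6(2H+3)⁴ corona plaquettes using L2 + translation invariance, the ¼Var term via L1b,
  the window inequality `K + 4δ + 2A < 2 + 2θ` makes it o(β^{−K}) against `BoxPolyFloor`).
* NOT carried from v1: `stub_bulkU1` (BC5 plan-only U(1) analogue) — superseded as the route's T3 witness by the LANDED even-side rarity theorem
  `plaquetteLargeFieldRarity_evenSide` (tribunal_fit.witness); it stays on the retired item's record.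
* `BulkDominatesColdBoxW_of` : the five stubs BY NAME ⇒ the crux BY NAME (θ := min θ₀ θ₁ᵃ θ₁ᵇ θ₁ᵏ; L3 at (θ/20, θ/5, θ, 2 + θ/2)).  Kernel-checked.
-/

open MeasureTheory Filter Topology
open Literature.MathematicalPhysics Literature.MathematicalPhysics.QuantumFieldTheory
open Literature.MathematicalPhysics.QuantumLattice
open Summit.QuantumFields.YangMills.Theorems Summit.QuantumFields.YangMills.Theorems.WeakCouplingRates

namespace Summit.QuantumFields.YangMills.Cruxes.BulkDominatesColdBoxW.DlrChessboard

/-! (v3) The posited objects `PlaquetteLargeFieldRarity`, `boxKernel`, `CrudeGood`, `GoodBoundaryCovStable`, `GoodBoundaryMeanSmooth`,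
`BoxPolyFloor`, `DlrAssembly` are the tree's (`Theorems.WeakCouplingRates.*`, module `WeakCouplingRatesBulkDominatesColdBoxWDefs`), opened above. -/

/-! ## Registered skeleton (BC3 shape): named stubs, parametric in the box exponent θ along (A, δ, θ, K) = (θ/20, θ/5, θ, 2 + θ/2),
and the kernel-checked composition concluding the rev-2 crux `BulkDominatesColdBoxW` BY NAME. -/

/-- L2 — crude single-plaquette large-field rarity, uniformly in the volume, at EVERY exponent δ > 0 (ALL large sides; even sides are the tree
theorem `Theorems.WeakCouplingRates.stub_largeFieldRarityEven`, odd sides need the mixed RP + odd-period chessboard folding). -/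
abbrev Stmt.stub_largeFieldRarity : Prop := ∀ δ : ℝ, 0 < δ → PlaquetteLargeFieldRarity δ

/-- L1a — deep covariances are stable under crude-good boundary data, along the family, under a ceiling θ₁ (one-scale small-field expansion). -/
abbrev Stmt.stub_goodBoundaryCovStable : Prop :=
  ∃ θ₁ : ℝ, 0 < θ₁ ∧ ∀ θ : ℝ, 0 < θ → θ ≤ θ₁ → ∃ η₁ : ℝ, 0 < η₁ ∧ GoodBoundaryCovStable (θ / 20) θ (θ / 5) η₁

/-- L1b — deep conditional means are position-smooth for crude-good boundary data, along the family, under a ceiling θ₁. -/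
abbrev Stmt.stub_goodBoundaryMeanSmooth : Prop :=
  ∃ θ₁ : ℝ, 0 < θ₁ ∧ ∀ θ : ℝ, 0 < θ → θ ≤ θ₁ → GoodBoundaryMeanSmooth (θ / 20) θ (θ / 5)

/-- Polynomial cold-box floor with exponent `K = 2 + θ/2` along the family, under a ceiling (= crux BOX_W + support FLOOR + arithmetic:
`2 + 8A = 2 + 0.4θ < 2 + θ/2`). -/
abbrev Stmt.stub_boxPolyFloor : Prop :=
  ∃ θ₁ : ℝ, 0 < θ₁ ∧ ∀ θ : ℝ, 0 < θ → θ ≤ θ₁ → BoxPolyFloor (θ / 20) θ (2 + θ / 2)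

/-- L3 — the DLR assembly (law of total covariance over `ymSpecification`, good/bad split, translation invariance, DLR consistency). -/
abbrev Stmt.stub_dlrAssembly : Prop := DlrAssembly

/-- The EVEN-SIDE half of L2, ALREADY A TREE THEOREM (`Theorems.WeakCouplingRates.stub_largeFieldRarityEven`, p411836, commit b5e5743fa1e6) — kept
registered so the landed proof stays credited to the crux; `stub_largeFieldRarity` (all large sides, all δ > 0) is what the composition consumes. -/
abbrev Stmt.stub_largeFieldRarityEven : Prop :=
  ∀ δ : ℝ, 0 < δ → ∃ β₀ : ℝ, ∀ β : ℝ, β₀ ≤ β → ∀ L : ℕ, Even (L + 1) →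
    Literature.MathematicalPhysics.QuantumFieldTheory.wilsonExpectation (L := L + 1)
        (Literature.MathematicalPhysics.QuantumLattice.fundamentalRep (Fin 2)) β
        (Literature.MathematicalPhysics.QuantumLattice.toTorusObservable (L + 1) fun U :
            Literature.MathematicalPhysics.QuantumLattice.LGConfig 4 (Matrix.specialUnitaryGroup (Fin 2) ℂ) =>
          if β ^ (2 * δ - 1) ≤ Summit.QuantumFields.YangMills.Theorems.WeakCouplingRates.plaqCost0
              (Literature.MathematicalPhysics.QuantumLattice.fundamentalRep (Fin 2)) 1 2 U then (1 : ℝ) else 0) ≤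
      Real.exp (-(β ^ δ))

/-- Proved in the tree: this is `Theorems.WeakCouplingRates.stub_largeFieldRarityEven` by name. -/
theorem stub_largeFieldRarityEven : Stmt.stub_largeFieldRarityEven :=
  Summit.QuantumFields.YangMills.Theorems.WeakCouplingRates.stub_largeFieldRarityEven

/-- (v3) CLOSED in the tree: `Theorems.WeakCouplingRates.stub_largeFieldRarity` (all torus sides, every δ > 0). -/
theorem stub_largeFieldRarity : ∀ δ : ℝ, 0 < δ → PlaquetteLargeFieldRarity δ :=
  Summit.QuantumFields.YangMills.Theorems.WeakCouplingRates.stub_largeFieldRarity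

theorem stub_goodBoundaryCovStable :
    ∃ θ₁ : ℝ, 0 < θ₁ ∧ ∀ θ : ℝ, 0 < θ → θ ≤ θ₁ → ∃ η₁ : ℝ, 0 < η₁ ∧ GoodBoundaryCovStable (θ / 20) θ (θ / 5) η₁ := by
  sorry

theorem stub_goodBoundaryMeanSmooth :
    ∃ θ₁ : ℝ, 0 < θ₁ ∧ ∀ θ : ℝ, 0 < θ → θ ≤ θ₁ → GoodBoundaryMeanSmooth (θ / 20) θ (θ / 5) := by
  sorry

theorem stub_boxPolyFloor : ∃ θ₁ : ℝ, 0 < θ₁ ∧ ∀ θ : ℝ, 0 < θ → θ ≤ θ₁ → BoxPolyFloor (θ / 20) θ (2 + θ / 2) := by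
  sorry

/-- (v4) CLOSED in the tree: `Theorems.WeakCouplingRates.stub_dlrAssembly`. -/
theorem stub_dlrAssembly : DlrAssembly :=
  Summit.QuantumFields.YangMills.Theorems.WeakCouplingRates.stub_dlrAssembly

/-- **The composition** (v4: the CLOSED stubs L2 `stub_largeFieldRarity` and L3 `stub_dlrAssembly` are discharged inside by their
tree theorems; the hypotheses are exactly the three OPEN stubs): given θ₀ > 0 take θ := min θ₀ (min θ₁ᵃ (min θ₁ᵇ θ₁ᵏ)) > 0 and apply
L3 at `(A, δ, θ, K) = (θ/20, θ/5, θ, 2 + θ/2)`; the window `K + 4δ + 2A = 2 + 1.4θ < 2 + 2θ`.  Concludes the route's rev-2 crux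
`BulkDominatesColdBoxW` BY NAME. -/
theorem BulkDominatesColdBoxW_of (h1a : Stmt.stub_goodBoundaryCovStable)
    (h1b : Stmt.stub_goodBoundaryMeanSmooth) (hK : Stmt.stub_boxPolyFloor) :
    Summit.QuantumFields.YangMills.Theses.WeakCouplingRates.BulkDominatesColdBoxW := by
  have h2 : Stmt.stub_largeFieldRarity := stub_largeFieldRarity
  have h3 : Stmt.stub_dlrAssembly := stub_dlrAssembly
  obtain ⟨θa, hθa, ha⟩ := h1a
  obtain ⟨θb, hθb, hb⟩ := h1b
  obtain ⟨θk, hθk, hk⟩ := hK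
  intro θ₀ hθ₀
  have hθpos : 0 < min θ₀ (min θa (min θb θk)) := lt_min hθ₀ (lt_min hθa (lt_min hθb hθk))
  have hθ0 : min θ₀ (min θa (min θb θk)) ≤ θ₀ := min_le_left _ _
  have hθa' : min θ₀ (min θa (min θb θk)) ≤ θa := le_trans (min_le_right _ _) (min_le_left _ _)
  have hθb' : min θ₀ (min θa (min θb θk)) ≤ θb :=
    le_trans (min_le_right _ _) (le_trans (min_le_right _ _) (min_le_left _ _))
  have hθk' : min θ₀ (min θa (min θb θk)) ≤ θk :=
    le_trans (min_le_right _ _) (le_trans (min_le_right _ _) (min_le_right _ _))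
  obtain ⟨η₁, hη, h1a'⟩ := ha _ hθpos hθa'
  refine ⟨min θ₀ (min θa (min θb θk)) / 20, min θ₀ (min θa (min θb θk)), by positivity, by linarith, hθ0, ?_⟩
  exact h3 _ _ _ η₁ _ (by positivity) (by positivity) hη (by linarith) h1a' (hb _ hθpos hθb') (h2 _ (by positivity)) (hk _ hθpos hθk')

/-- Signature match: the composition applied to the OPEN stubs has literally the route's rev-2 crux as its type. -/
example : Summit.QuantumFields.YangMills.Theses.WeakCouplingRates.BulkDominatesColdBoxW :=
  BulkDominatesColdBoxW_of stub_goodBoundaryCovStable stub_goodBoundaryMeanSmooth stub_boxPolyFloor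

end Summit.QuantumFields.YangMills.Cruxes.BulkDominatesColdBoxW.DlrChessboard
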